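import Summits.CriticalPhenomena.PercolationContinuityZ3.Theorems.PercNearOneGluingNoHeavyPcintClusterExploration
import Summits.CriticalPhenomena.PercolationContinuityZ3.Theorems.PercNearOneGluingNoHeavyPcintAdaptiveDominationTools
import Summits.CriticalPhenomena.PercolationContinuityZ3.Theorems.PercNearOneGluingNoHeavyPcintAdaptiveDominationMarginals
import Literature.Probability.Percolation.Percolation
import Literature.Probability.LatticeModels.LatticeGraph
import HarnessLib

/-!
# PCINT lane: Hammersley's site-versus-bond comparison, step 1a — product weights and the bond-exploration oracle

Cell `prim-pcint`, seat `prim-pcint-2` (gen 16).  Target of the chain (…SiteBondWeights → …SiteBondProcess → …SiteBondBox →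
…SiteBondComparison): `θ^site_v(p) ≤ θ^bond_v(p)` on every locally finite graph, hence `p_c^bond(G) ≤ p_c^site(G)`
(J. M. Hammersley, *Comparison of atom and bond percolation processes*, J. Math. Phys. 2 (1961) 728–733; Grimmett 1999
Thm (1.33), second inequality of (1.34), proved in print through the dynamic coupling (1.35) `C^site(p) ≤_st C^bond(p)`; the
tree's `SiteBondCriticalPoints.lean` records it as a TODO).  The proof runs the lane's COUPLING-FREE dynamic comparison
`AdaptDom.expect_le_of_dominating` (…PcintAdaptiveDomination) with the cluster exploration `ClusterExpl.rule`
(…PcintClusterExploration); process 2 is bond percolation on a finite vertex set `Λ`.  This file holds the OBJECTS: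

* `ProdWt.pwt f a = ∏_e f e (a e)` — product weights with coordinate-dependent factors on a cube `E → Bool` (bond weights are
  `p`/`1-p` on edges of `G`, `0`/`1` on non-edges), with the toolkit of `AdaptDom` re-proved for them: `sum_pwt`,
  `sum_sum_mix_pwt`, **`sum_pwt_mul_mul_of_indep`** (functions of disjoint coordinate sets are uncorrelated),
  `sum_pwt_filter_agree`, `sum_pwt_mul_eq_sum_slice`;
* `SiteBond.bx G Λ` (the graph induced on `Λ`), `SiteBond.ek` (the coordinate `s(x, y) ∈ Λ.sym2` of a pair of sites),
  `SiteBond.ef` (one-coordinate bond weights), `SiteBond.bondWt` (their product = the law of `P_p` on the pairs of `Λ`, step 2),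
  **`SiteBond.bondOut`** — the oracle: at the root step report `open`; when the exploration examines the unrevealed neighbours `v`
  of the selected site `b`, report the state of the EDGE `{b, v}`; `propCfgEquiv`, `boxArm` (objects of the box inequality).

Step 1b (…PcintSiteBondProcess) proves the step-wise domination `SiteBond.dominating`.
-/


namespace Summit.CriticalPhenomena.PercolationContinuityZ3.Theorems.Pcint

open Finset AdaptDom

/-! ### Product weights with coordinate-dependent factors -/

namespace ProdWt

variable {E : Type*} [Fintype E] [DecidableEq E]

/-- The product weight `∏_e f e (a e)` of a point `a` of the cube `E → Bool`. -/
def pwt (f : E → Bool → ℝ) (a : E → Bool) : ℝ := ∏ e, f e (a e)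

omit [DecidableEq E] in
/-- Product weights with nonnegative factors are nonnegative. -/
theorem pwt_nonneg {f : E → Bool → ℝ} (hf0 : ∀ e b, 0 ≤ f e b) (a : E → Bool) : 0 ≤ pwt f a :=
  Finset.prod_nonneg fun e _ => hf0 e (a e)

/-- If every factor is a probability weight on `Bool`, the product weight has total mass `1`. -/
theorem sum_pwt {f : E → Bool → ℝ} (hf : ∀ e, f e true + f e false = 1) : ∑ a : E → Bool, pwt f a = 1 := by
  unfold pwt
  rw [← Fintype.piFinset_univ, ← Finset.prod_univ_sum (fun _ => (univ : Finset Bool)) fun e b => f e b]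
  simp [hf]

/-- Swapping the `S`-coordinates of two points preserves the product of their weights. -/
theorem pwt_mix_mul_pwt_mix (f : E → Bool → ℝ) (S : Finset E) (a a' : E → Bool) :
    pwt f (mix S a a') * pwt f (mix S a' a) = pwt f a * pwt f a' := by
  unfold pwt
  rw [← Finset.prod_mul_distrib, ← Finset.prod_mul_distrib]
  refine Finset.prod_congr rfl fun e _ => ?_
  unfold mix
  split_ifs
  · rfl
  · exact mul_comm _ _

/-- **Integrating out the mixed-in coordinates** (the `pwt` version of `AdaptDom.sum_sum_mix`):
`Σ_a Σ_a' w(a) w(a') G(mix S a a') = Σ_a w(a) G(a)`. -/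
theorem sum_sum_mix_pwt {f : E → Bool → ℝ} (hf : ∀ e, f e true + f e false = 1) (S : Finset E)
    (G : (E → Bool) → ℝ) :
    ∑ a : E → Bool, ∑ a' : E → Bool, pwt f a * pwt f a' * G (mix S a a') = ∑ a : E → Bool, pwt f a * G a := by
  have h1 : ∑ a : E → Bool, ∑ a' : E → Bool, pwt f a * pwt f a' * G (mix S a a') =
      ∑ z : (E → Bool) × (E → Bool), pwt f z.1 * pwt f z.2 * G (mix S z.1 z.2) := by
    rw [Fintype.sum_prod_type]
  have h2 : ∑ a : E → Bool, pwt f a * G a = ∑ z : (E → Bool) × (E → Bool), pwt f z.1 * pwt f z.2 * G z.1 := by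
    rw [Fintype.sum_prod_type]
    refine Finset.sum_congr rfl fun a _ => ?_
    simp_rw [mul_right_comm (pwt f a) _ (G a)]
    rw [← Finset.mul_sum, sum_pwt hf, mul_one]
  rw [h1, h2]
  refine Fintype.sum_equiv ((swapOn_involutive S).toPerm _) _ _ fun z => ?_
  obtain ⟨a, a'⟩ := z
  change pwt f a * pwt f a' * G (mix S a a') = pwt f (mix S a a') * pwt f (mix S a' a) * G (mix S a a')
  rw [pwt_mix_mul_pwt_mix]

/-- **Functions of disjoint coordinate sets are uncorrelated**: if `F₁` does not read the coordinates in `S` and `F₂` reads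
only those, then `E[F₁ F₂] = E[F₁] E[F₂]` under the product weight. -/
theorem sum_pwt_mul_mul_of_indep {f : E → Bool → ℝ} (hf : ∀ e, f e true + f e false = 1) (S : Finset E)
    (F₁ F₂ : (E → Bool) → ℝ) (h₁ : ∀ a a', F₁ (mix S a a') = F₁ a') (h₂ : ∀ a a', F₂ (mix S a a') = F₂ a) :
    ∑ a : E → Bool, pwt f a * (F₁ a * F₂ a) =
      (∑ a : E → Bool, pwt f a * F₁ a) * ∑ a : E → Bool, pwt f a * F₂ a := by
  rw [← sum_sum_mix_pwt hf S (fun a => F₁ a * F₂ a)]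
  simp only [h₁, h₂]
  calc ∑ a : E → Bool, ∑ a' : E → Bool, pwt f a * pwt f a' * (F₁ a' * F₂ a)
      = ∑ a : E → Bool, (pwt f a * F₂ a) * ∑ a' : E → Bool, pwt f a' * F₁ a' := by
        refine Finset.sum_congr rfl fun a _ => ?_
        rw [Finset.mul_sum]
        exact Finset.sum_congr rfl fun a' _ => by ring
    _ = (∑ a : E → Bool, pwt f a * F₂ a) * ∑ a' : E → Bool, pwt f a' * F₁ a' := by rw [Finset.sum_mul]
    _ = _ := mul_comm _ _

/-- **Marginal of the product weight**: the points agreeing with `x` on `S` have total weight `∏_{e ∈ S} f e (x e)`. -/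
theorem sum_pwt_filter_agree {f : E → Bool → ℝ} (hf : ∀ e, f e true + f e false = 1) (S : Finset E) (x : E → Bool) :
    ∑ a ∈ univ.filter (fun a : E → Bool => ∀ e ∈ S, a e = x e), pwt f a = ∏ e ∈ S, f e (x e) := by
  classical
  let t : E → Finset Bool := fun e => if e ∈ S then {x e} else univ
  have hset : univ.filter (fun a : E → Bool => ∀ e ∈ S, a e = x e) = Fintype.piFinset t := by
    ext a
    simp only [mem_filter, mem_univ, true_and, Fintype.mem_piFinset, t]
    constructor
    · intro h e
      by_cases he : e ∈ S
      · rw [if_pos he, mem_singleton]; exact h e he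
      · rw [if_neg he]; exact mem_univ _
    · intro h e he
      have := h e; rw [if_pos he, mem_singleton] at this; exact this
  rw [hset]
  unfold pwt
  rw [← Finset.prod_univ_sum t fun e b => f e b, ← Finset.prod_filter_mul_prod_filter_not univ (· ∈ S)]
  have h1 : ∏ e ∈ univ.filter (· ∈ S), ∑ b ∈ t e, f e b = ∏ e ∈ S, f e (x e) := by
    have hS : univ.filter (· ∈ S) = S := by ext e; simp
    rw [hS]
    refine Finset.prod_congr rfl fun e he => ?_
    simp only [t, if_pos he, sum_singleton]
  have h2 : ∏ e ∈ univ.filter (fun e => ¬ e ∈ S), ∑ b ∈ t e, f e b = 1 := by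
    refine Finset.prod_eq_one fun e he => ?_
    have heS : e ∉ S := (mem_filter.1 he).2
    simp only [t, if_neg heS, Fintype.sum_bool]
    exact hf e
  rw [h1, h2, mul_one]

/-- **Expectation of a function reading only the coordinates in `S`** as a sum over outcome patterns:
`Σ_a w(a) h(a) = Σ_{x ∈ slice S x₀} (∏_{e ∈ S} f e (x e)) h x`. -/
theorem sum_pwt_mul_eq_sum_slice {f : E → Bool → ℝ} (hf : ∀ e, f e true + f e false = 1) (S : Finset E)
    (x₀ : E → Bool) (h : (E → Bool) → ℝ) (hh : ∀ a, h a = h (mix S a x₀)) :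
    ∑ a : E → Bool, pwt f a * h a = ∑ x ∈ slice S x₀, (∏ e ∈ S, f e (x e)) * h x := by
  classical
  have step1 : ∀ a : E → Bool, pwt f a * h a = ∑ x ∈ slice S x₀, if mix S a x₀ = x then pwt f a * h x else 0 := by
    intro a
    have hmem : mix S a x₀ ∈ slice S x₀ := mem_filter.2 ⟨mem_univ _, mix_mem_slice_aux S a x₀⟩
    simp only [Finset.sum_ite_eq, hmem, if_true]
    rw [← hh a]
  rw [Finset.sum_congr rfl fun a _ => step1 a, Finset.sum_comm]
  refine Finset.sum_congr rfl fun x hx => ?_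
  have hx' : ∀ e, e ∉ S → x e = x₀ e := (mem_filter.1 hx).2
  have : ∑ a : E → Bool, (if mix S a x₀ = x then pwt f a * h x else 0) =
      (∑ a ∈ univ.filter (fun a : E → Bool => ∀ e ∈ S, a e = x e), pwt f a) * h x := by
    rw [Finset.sum_mul, Finset.sum_filter]
    refine Finset.sum_congr rfl fun a _ => ?_
    by_cases h1 : mix S a x₀ = x
    · rw [if_pos h1, if_pos ((mix_eq_iff_of_mem_slice hx' a).1 h1)]
    · rw [if_neg h1, if_neg (fun h2 => h1 ((mix_eq_iff_of_mem_slice hx' a).2 h2))]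
  rw [this, sum_pwt_filter_agree hf]

end ProdWt

/-! ### Process 2: bond percolation on a finite vertex set, explored along `ClusterExpl.rule` -/

namespace SiteBond

open ClusterExpl ProdWt

variable {V : Type*} (G : SimpleGraph V) (Λ : Finset V)

/-- The graph `G` induced on the finite vertex set `Λ` (as a graph on the subtype `↥Λ`). -/
def bx : SimpleGraph ↥Λ := SimpleGraph.comap (fun v : ↥Λ => v.1) G

/-- Adjacency in `bx G Λ` is adjacency in `G`. -/
theorem bx_adj {a b : ↥Λ} : (bx G Λ).Adj a b ↔ G.Adj a.1 b.1 := Iff.rfl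

/-- Adjacency in `bx G Λ` is decidable. -/
instance instDecidableRelBxAdj [DecidableRel G.Adj] : DecidableRel (bx G Λ).Adj := fun a b =>
  inferInstanceAs (Decidable (G.Adj a.1 b.1))

variable {Λ} in
/-- The coordinate `s(x, y) ∈ Λ.sym2` of a pair of sites of `Λ` (the edge `{x, y}` when `x ∼ y`). -/
def ek (x y : ↥Λ) : ↥(Λ.sym2) := ⟨s(x.1, y.1), Finset.mk_mem_sym2_iff.2 ⟨x.2, y.2⟩⟩

variable {Λ} in
/-- The underlying pair of `ek x y`. -/
@[simp] theorem ek_val (x y : ↥Λ) : (ek x y).1 = s(x.1, y.1) := rfl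

variable {Λ} in
/-- `ek x` is injective. -/
theorem ek_injective (x : ↥Λ) : Function.Injective (ek (Λ := Λ) x) := by
  intro y y' h
  have h' : s(x.1, y.1) = s(x.1, y'.1) := congrArg Subtype.val h
  rcases Sym2.eq_iff.1 h' with ⟨-, h2⟩ | ⟨h1, h2⟩
  · exact Subtype.ext h2
  · exact Subtype.ext (h2.trans h1)

variable {Λ} in
/-- `ek x y = ek x' y'` forces `{x, y} = {x', y'}`. -/
theorem ek_eq_ek_iff {x y x' y' : ↥Λ} : ek x y = ek x' y' ↔ (x = x' ∧ y = y') ∨ (x = y' ∧ y = x') := by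
  constructor
  · intro h
    have h' : s(x.1, y.1) = s(x'.1, y'.1) := congrArg Subtype.val h
    rcases Sym2.eq_iff.1 h' with ⟨h1, h2⟩ | ⟨h1, h2⟩
    · exact Or.inl ⟨Subtype.ext h1, Subtype.ext h2⟩
    · exact Or.inr ⟨Subtype.ext h1, Subtype.ext h2⟩
  · rintro (⟨rfl, rfl⟩ | ⟨rfl, rfl⟩)
    · rfl
    · exact Subtype.ext Sym2.eq_swap

open Classical in
/-- The one-coordinate bond weights of `P_p`: an edge of `G` is open with weight `p`, closed with weight `1 - p`; a
non-edge is open with weight `0`, closed with weight `1` (the factors of the tree's `cylWeight`, see step 2). -/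
noncomputable def ef (p : ℝ) (e : Sym2 V) : Bool → ℝ
  | true => if e ∈ G.edgeSet then p else 0
  | false => if e ∈ G.edgeSet then 1 - p else 1

/-- Each coordinate weight is a probability weight on `Bool`. -/
theorem ef_true_add_ef_false (p : ℝ) (e : Sym2 V) : ef G p e true + ef G p e false = 1 := by
  simp only [ef]; split_ifs <;> ring

/-- The coordinate weights are nonnegative for `p ∈ [0, 1]`. -/
theorem ef_nonneg {p : ℝ} (hp0 : 0 ≤ p) (hp1 : p ≤ 1) (e : Sym2 V) (b : Bool) : 0 ≤ ef G p e b := by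
  cases b <;> simp only [ef] <;> split_ifs <;> linarith

/-- On an edge of `G` the coordinate weight is the Bernoulli weight `bern p`. -/
theorem ef_of_mem_edgeSet (p : ℝ) {e : Sym2 V} (he : e ∈ G.edgeSet) (b : Bool) : ef G p e b = bern p b := by
  cases b <;> simp [ef, bern, he]

variable [DecidableEq V]

/-- **The bond weight** on the cube `Λ.sym2 → Bool` of edge configurations inside `Λ`: the finite-dimensional law of
`P_p` on the pairs of `Λ` (step 2 identifies it with the tree's `cylWeight G p Λ.sym2`). -/
noncomputable abbrev bondWt (p : ℝ) (w : ↥(Λ.sym2) → Bool) : ℝ := pwt (fun e : ↥(Λ.sym2) => ef G p e.1) w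

/-- The bond weight is a probability weight. -/
theorem sum_bondWt (p : ℝ) : ∑ w : ↥(Λ.sym2) → Bool, bondWt G Λ p w = 1 :=
  sum_pwt fun e => ef_true_add_ef_false G p e.1

omit [DecidableEq V] in
/-- The bond weight is nonnegative for `p ∈ [0, 1]`. -/
theorem bondWt_nonneg {p : ℝ} (hp0 : 0 ≤ p) (hp1 : p ≤ 1) (w : ↥(Λ.sym2) → Bool) : 0 ≤ bondWt G Λ p w :=
  pwt_nonneg (fun e b => ef_nonneg G hp0 hp1 e.1 b) w

variable [DecidableRel G.Adj] (enc : ↥Λ → ℕ)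

/-- **The bond oracle**: at the root step report `open` (the root belongs to its own bond cluster); afterwards, when the
site `v` is examined from the selected site `b`, report the state of the edge `{b, v}`. -/
noncomputable def bondOut (w : ↥(Λ.sym2) → Bool) (σ : ↥Λ → Option Bool) (v : ↥Λ) : Bool :=
  if ∀ u, σ u = none then true
  else match sel (bx G Λ) enc σ with
    | none => false
    | some b => w (ek b v)

variable {G Λ enc}

omit [DecidableEq V] in
/-- At the initial state the oracle reports `open`. -/
theorem bondOut_of_init {σ : ↥Λ → Option Bool} (h : ∀ u, σ u = none) (w : ↥(Λ.sym2) → Bool) (v : ↥Λ) :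
    bondOut G Λ enc w σ v = true := by
  unfold bondOut; rw [if_pos h]

omit [DecidableEq V] in
/-- When no site is selected (non-initial state) the oracle reports `closed` (the rule examines nothing then). -/
theorem bondOut_of_sel_none {σ : ↥Λ → Option Bool} (h : ¬ ∀ u, σ u = none) (hsel : sel (bx G Λ) enc σ = none)
    (w : ↥(Λ.sym2) → Bool) (v : ↥Λ) : bondOut G Λ enc w σ v = false := by
  unfold bondOut; rw [if_neg h, hsel]

omit [DecidableEq V] in
/-- When `b` is selected the oracle reads the edge `{b, v}`. -/
theorem bondOut_of_sel_some {σ : ↥Λ → Option Bool} (h : ¬ ∀ u, σ u = none) {b : ↥Λ}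
    (hsel : sel (bx G Λ) enc σ = some b) (w : ↥(Λ.sym2) → Bool) (v : ↥Λ) : bondOut G Λ enc w σ v = w (ek b v) := by
  unfold bondOut; rw [if_neg h, hsel]

/-! ### The rule, the reported pattern -/

variable (G Λ enc) in
/-- Shorthand: the exploration rule on the box with root `o`. -/
noncomputable abbrev R (o : ↥Λ) : (↥Λ → Option Bool) → Finset ↥Λ := rule (bx G Λ) enc o

omit [DecidableEq V] in
/-- A selected site is revealed open. -/
theorem eq_some_true_of_sel {σ : ↥Λ → Option Bool} {b : ↥Λ} (hsel : sel (bx G Λ) enc σ = some b) : σ b = some true :=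
  (mem_filter.1 (sel_spec (bx G Λ) enc hsel).1).2.1

/-- The pattern reported on the examined sites `S`: `v ↦ w {b, v}` on `S`, `closed` elsewhere. -/
def pat (b : ↥Λ) (S : Finset ↥Λ) (w : ↥(Λ.sym2) → Bool) : ↥Λ → Bool :=
  fun v => if v ∈ S then w (ek b v) else false

/-- The inverse reading: an outcome pattern `y` on `S` as an edge configuration supported on the edges `{b, v}`, `v ∈ S`. -/
noncomputable def unpat (b : ↥Λ) (S : Finset ↥Λ) (y : ↥Λ → Bool) : ↥(Λ.sym2) → Bool :=
  fun e => if h : ∃ v ∈ S, ek b v = e then y (Classical.choose h) else false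

omit [DecidableEq V] in
/-- The chosen preimage of `ek b v` is `v`. -/
theorem choose_ek_eq {b : ↥Λ} {S : Finset ↥Λ} {v : ↥Λ} (h : ∃ v' ∈ S, ek b v' = ek b v) :
    Classical.choose h = v :=
  ek_injective b (Classical.choose_spec h).2

/-! ### Objects of step 2 (the box inequality, …PcintSiteBondBox) -/

section BoxObjects

variable (G Λ)

/-- The `Prop`-valued site configuration of a `Bool`-valued one, as an equivalence `(Λ → Bool) ≃ (Λ → Prop)` (the tree's
site weights `siteWeight` live on `Λ → Prop`, `AdaptDom.wt` on `Λ → Bool`). -/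
noncomputable def propCfgEquiv : (↥Λ → Bool) ≃ (↥Λ → Prop) where
  toFun ω := fun v => ω v = true
  invFun y := fun v => @decide (y v) (Classical.dec _)
  left_inv ω := by funext v; simp
  right_inv y := by funext v; simp

/-- **The bond exit event of the box** `{o ⟷ ∂ⁱⁿΛ in Λ}`: some inner-boundary site of `Λ` is joined to `o` by a path of
open edges inside `Λ` (for `Λ = B(o, n)` this is the tree's `DCTQ.armEvent G o n`). -/
def boxArm [G.LocallyFinite] (o : V) : Set (Literature.Probability.Percolation.BondConfig V) :=
  {ω | ∃ b ∈ Literature.Probability.LatticeModels.innerBoundary G Λ,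
    ω ∈ Literature.Probability.Percolation.openConnIn (↑Λ : Set V) o b}

end BoxObjects

end SiteBond

end Summit.CriticalPhenomena.PercolationContinuityZ3.Theorems.Pcint
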